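import Summits.CriticalPhenomena.SAWScalingLimit.Theses.SAWWeldingIdentification
import Summits.CriticalPhenomena.SAWScalingLimit.Theses.SAWLoopFugacityFlow
import Summits.CriticalPhenomena.SAWScalingLimit.Theorems.SAWWeldingIdentificationWeldingSetup
import Summits.CriticalPhenomena.SAWScalingLimit.Theorems.SAWWeldingIdentificationWeldingLawOfLimitNecessity
import Literature.Probability.RandomPlanarGeometry.ConformalWelding

/-!
# Line `stable_proxies` for crux `WeldingLawOfLimit` (stmt-CriticalPhenomena-4502),
# route `SAWWeldingIdentification` — strategist (cstrat r1), 2026-08-17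

The crux, BY NAME: `Summit.CriticalPhenomena.SAWScalingLimit.Theses.SAWWeldingIdentification.WeldingLawOfLimit`.

## Where this line sits

Route-level redirect (BC2, human ruling 2026-08-16): `WeldingLawOfLimit` (W) is DERIVED from the two
route leaves

* `SimpleSubseqLimits` (shared item stmt-CriticalPhenomena-4982: every subsequential weak limit of the
  critical SAW laws is carried by simple chords), and
* `LatticeWeldingLaw` (L: chord proxies of the critical `ℤ²` SAW whose canonical-welding marginals
  converge to SLE_{8/3}'s — a `P`-free lattice statement),

by the LANDED assembly
`Theorems.WeldingLawOfLimit.weldingLawOfLimit_of_simpleSubseqLimits_of_latticeWeldingLaw` (p161228;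
a non-trivial seam: converging together on varying spaces, continuous mapping on the Borel chord set,
welding uniqueness). This file is the PLAN FOR THE LEAF `L`: it cuts `L` one level down into

* `stub_stableChordProxies` (A PRIORI, lattice): chord proxies of the walk exist whose canonical
  welding is STABLE in probability — at every fixed parameter `x > 0`, perturbing the proxy by less
  than `ρ` inside the simple chords moves `conformalWelding Q · x` by less than `ε`, except on an event
  of probability `≤ η`, eventually in the mesh ("no gate of vanishing width carries macroscopic two-sided
  harmonic flux at the marked scale"); and
* `stub_weldingLawOfStableProxies` (IDENTIFICATION, lattice): EVERY stable chord-proxy family has the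
  SLE_{8/3} welding marginals (the route's bet — bank independence / Sheffield's zipper — in the exact
  form a lattice argument on a regular family would prove it).

Sorry-free glue: `latticeWeldingLaw_of` (take the stable family, apply identification) and
`WeldingLawOfLimit_of : stub_simpleSubseqLimits → stub_stableChordProxies →
stub_weldingLawOfStableProxies → WeldingLawOfLimit` (through the landed assembly).

## What stability buys (kernel-checked here)

`HasSLEWeldingLaw.transfer`: if one chord-proxy family has the SLE_{8/3} welding marginals, then so does
every STABLE chord-proxy family (converging together on `ℝᵏ`, the tree's
`tendsto_integral_comp_of_tendsto_measureReal_lt_dist`, fed by the stability estimate). Hence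
`weldingLawOfStableProxies_of_latticeWeldingLaw : L → stub_weldingLawOfStableProxies` (the
identification stub is a CONSEQUENCE of `L`, so of the conjunct: `…_of_sawScalingLimit`), and
`latticeWeldingLaw_iff_of_stableChordProxies : stub_stableChordProxies → (L ↔ stub_weldingLawOfStableProxies)`.
Neither stub gives `L` alone: without a stable family the identification stub is silent, and stability
says nothing about the law. `isWeldingStable_const` (a frozen simple chord is stable, by
`continuousOn_conformalWelding`) shows the stability predicate is the in-probability, uniform-in-mesh
version of the welding continuity the route already proved (`WeldingContinuity`, stmt-4509).

## Disproof / negatives used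
No `Disproof.lean` for this crux (`ledger crux ls stmt-CriticalPhenomena-4502`, 2026-08-17T14:4xZ).
`ledger negatives --problem CriticalPhenomena`: nothing on 4502 / 4982 / 0783 / 1372 bears on these stubs
(stmt-0772, all-δ tightness, is not claimed: every statement here is along a sequence, eventually).
-/

noncomputable section

open MeasureTheory Filter Topology Set
open scoped BoundedContinuousFunction
open Literature.Probability.RandomPlanarGeometry Literature.Probability.LatticeModels
open Literature.Probability.Process (preWienerMeasure)
open Summit.CriticalPhenomena.SAWScalingLimit.Theses
open Summit.CriticalPhenomena.SAWScalingLimit.Theorems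

namespace Summit.CriticalPhenomena.SAWScalingLimit.Cruxes.WeldingLawOfLimit.StableProxies

/-! ### 1. Vocabulary (abbreviations over existing declarations only) -/

/-- A family of **chord proxies** of the critical SAW in `(Q.chord 0 2; a_δ, b_δ)` along `δₙ`: any
functions `cₙ` of the walk (the SAW σ-algebra is discrete) that are eventually almost surely simple
chords of `(Ω; a, b)` and close to the walk in probability. Verbatim the first two clauses of the
leaf `LatticeWeldingLaw`. -/
def IsChordProxy (Q : ConformalRectangle) (δs : ℕ → ℝ) (a b : ℝ → Site 2)
    (c : (n : ℕ) → SAW.DomainSAW Q.carrier (δs n) (a (δs n)) (b (δs n)) → CurveClass ℂ) : Prop :=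
  (∀ᶠ n in atTop, ∀ᵐ ω ∂(SAW.law Q.carrier (δs n) (a (δs n)) (b (δs n))),
      (Q.chord 0 2 (by decide)).IsSimpleChord (c n ω)) ∧
  (∀ ε : ℝ, 0 < ε →
      Tendsto (fun n => (SAW.law Q.carrier (δs n) (a (δs n)) (b (δs n))).real
        {ω | ε < dist ω.curve (c n ω)}) atTop (𝓝 0))

/-- **Welding stability** of a proxy family (the a-priori input the welding functional needs): for
every parameter `x > 0`, accuracy `ε > 0` and confidence `η > 0` there is a perturbation radius
`ρ > 0` such that, eventually in `n`, with probability at least `1 - η` NO simple chord within `ρ` of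
the proxy `cₙ ω` has its canonical welding at `x` differing from that of `cₙ ω` by `ε` or more. -/
def IsWeldingStable (Q : ConformalRectangle) (δs : ℕ → ℝ) (a b : ℝ → Site 2)
    (c : (n : ℕ) → SAW.DomainSAW Q.carrier (δs n) (a (δs n)) (b (δs n)) → CurveClass ℂ) : Prop :=
  ∀ x : ℝ, 0 < x → ∀ ε : ℝ, 0 < ε → ∀ η : ℝ, 0 < η → ∃ ρ : ℝ, 0 < ρ ∧
    ∀ᶠ n in atTop, (SAW.law Q.carrier (δs n) (a (δs n)) (b (δs n))).real
      {ω | ∃ γ' : CurveClass ℂ, (Q.chord 0 2 (by decide)).IsSimpleChord γ' ∧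
        dist γ' (c n ω) < ρ ∧
        ε ≤ |conformalWelding Q γ' x - conformalWelding Q (c n ω) x|} ≤ η

/-- The proxies **carry the SLE_{8/3} welding law**: all finite-dimensional marginals of their
canonical welding at positive points converge to those of chordal SLE_{8/3} in `(Ω; a, b)`. Verbatim
the last clause of the leaf `LatticeWeldingLaw`. -/
def HasSLEWeldingLaw (Q : ConformalRectangle) (δs : ℕ → ℝ) (a b : ℝ → Site 2)
    (c : (n : ℕ) → SAW.DomainSAW Q.carrier (δs n) (a (δs n)) (b (δs n)) → CurveClass ℂ) : Prop :=
  ∀ Γ : (NNReal → ℝ) → CurveClass ℂ,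
    IsSLECurve ((8 : NNReal) / 3) (Q.chord 0 2 (by decide)) Γ →
    ∀ (k : ℕ) (x : Fin k → ℝ), (∀ i, 0 < x i) →
    ∀ g : BoundedContinuousFunction (Fin k → ℝ) ℝ,
      Tendsto (fun n => ∫ ω, g (fun i => conformalWelding Q (c n ω) (x i))
          ∂(SAW.law Q.carrier (δs n) (a (δs n)) (b (δs n)))) atTop
        (𝓝 (∫ γ, g (fun i => conformalWelding Q γ (x i)) ∂(preWienerMeasure.map Γ)))

/-- **The leaf `LatticeWeldingLaw`** (route child of `WeldingLawOfLimit`; verbatim the registered stub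
`stub_latticeWeldingLaw` of line `registered` v4 and the hypothesis of the landed assembly
`weldingLawOfLimit_of_simpleSubseqLimits_of_latticeWeldingLaw`). -/
def LatticeWeldingLaw : Prop :=
  ∀ (Q : ConformalRectangle) (a b : ℝ → Site 2),
    SAW.IsEndpointApprox (Q.chord 0 2 (by decide)) a b →
    ∀ (δs : ℕ → ℝ), (∀ n, 0 < δs n) → Tendsto δs atTop (𝓝 0) →
    ∃ c : (n : ℕ) → SAW.DomainSAW Q.carrier (δs n) (a (δs n)) (b (δs n)) → CurveClass ℂ,
      (∀ᶠ n in atTop, ∀ᵐ ω ∂(SAW.law Q.carrier (δs n) (a (δs n)) (b (δs n))),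
        (Q.chord 0 2 (by decide)).IsSimpleChord (c n ω)) ∧
      (∀ ε : ℝ, 0 < ε →
        Tendsto (fun n => (SAW.law Q.carrier (δs n) (a (δs n)) (b (δs n))).real
          {ω | ε < dist ω.curve (c n ω)}) atTop (𝓝 0)) ∧
      ∀ Γ : (NNReal → ℝ) → CurveClass ℂ,
        IsSLECurve ((8 : NNReal) / 3) (Q.chord 0 2 (by decide)) Γ →
        ∀ (k : ℕ) (x : Fin k → ℝ), (∀ i, 0 < x i) →
        ∀ g : BoundedContinuousFunction (Fin k → ℝ) ℝ,
          Tendsto (fun n => ∫ ω, g (fun i => conformalWelding Q (c n ω) (x i))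
              ∂(SAW.law Q.carrier (δs n) (a (δs n)) (b (δs n)))) atTop
            (𝓝 (∫ γ, g (fun i => conformalWelding Q γ (x i)) ∂(preWienerMeasure.map Γ)))

/-- **Stub A (a priori): stable chord proxies exist** for the critical `ℤ²` SAW in every conformal
rectangle, under every endpoint approximation, along every positive `δₙ → 0`. -/
def StableChordProxies : Prop :=
  ∀ (Q : ConformalRectangle) (a b : ℝ → Site 2),
    SAW.IsEndpointApprox (Q.chord 0 2 (by decide)) a b →
    ∀ (δs : ℕ → ℝ), (∀ n, 0 < δs n) → Tendsto δs atTop (𝓝 0) →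
    ∃ c : (n : ℕ) → SAW.DomainSAW Q.carrier (δs n) (a (δs n)) (b (δs n)) → CurveClass ℂ,
      IsChordProxy Q δs a b c ∧ IsWeldingStable Q δs a b c

/-- **Stub B (identification): every stable chord-proxy family carries the SLE_{8/3} welding law.** -/
def WeldingLawOfStableProxies : Prop :=
  ∀ (Q : ConformalRectangle) (a b : ℝ → Site 2),
    SAW.IsEndpointApprox (Q.chord 0 2 (by decide)) a b →
    ∀ (δs : ℕ → ℝ), (∀ n, 0 < δs n) → Tendsto δs atTop (𝓝 0) →
    ∀ c : (n : ℕ) → SAW.DomainSAW Q.carrier (δs n) (a (δs n)) (b (δs n)) → CurveClass ℂ,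
      IsChordProxy Q δs a b c → IsWeldingStable Q δs a b c → HasSLEWeldingLaw Q δs a b c

/-! ### 2. The registered stubs -/

/-- STUB 1 = the shared crux item stmt-CriticalPhenomena-4982 `SimpleSubseqLimits` BY NAME (route
leaf after the split; open problem with its own campaign — not attacked on this line). -/
theorem stub_simpleSubseqLimits : SAWLoopFugacityFlow.SimpleSubseqLimits := by
  sorry

/-- STUB A (open; a-priori lattice regularity: gate-freeness of the two banks of the critical SAW at
the marked scale, in probability, uniformly in the mesh). -/
theorem stub_stableChordProxies : StableChordProxies := by
  sorry

/-- STUB B (open; the route's bet — identification of the lattice welding law of regular families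
with the SLE_{8/3} welding law; engine: bank independence + Sheffield's quantum zipper at
`γ = √(8/3)`, welding uniqueness AJKS / KMS). -/
theorem stub_weldingLawOfStableProxies : WeldingLawOfStableProxies := by
  sorry

namespace Registered

/-- Alias keyed by the registered stub name. -/
abbrev stub_simpleSubseqLimits : Prop := SAWLoopFugacityFlow.SimpleSubseqLimits
/-- Alias keyed by the registered stub name. -/
abbrev stub_stableChordProxies : Prop := StableChordProxies
/-- Alias keyed by the registered stub name. -/
abbrev stub_weldingLawOfStableProxies : Prop := WeldingLawOfStableProxies

end Registered

/-! ### 3. Sorry-free glue -/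

section Glue

variable {Q : ConformalRectangle} {δs : ℕ → ℝ} {a b : ℝ → Site 2}

/-- The critical SAW law is a finite measure (a probability measure or zero). [folklore] -/
theorem isFiniteMeasure_law (Ω : Set ℂ) (δ : ℝ) (u v : Site 2) :
    IsFiniteMeasure (SAW.law Ω δ u v) := by
  rcases Summit.CriticalPhenomena.SAWScalingLimit.Theorems.SubseqIdentification.Negative.isProbabilityMeasure_law_or_eq_zero Ω δ u v with h | h
  · infer_instance
  · rw [h]; infer_instance

/-- **A frozen simple chord is welding-stable**: the stability predicate is the in-probability,
uniform-in-mesh form of the continuity of the welding on simple chords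
(`continuousOn_conformalWelding`). [folklore] -/
theorem isWeldingStable_const {γ₀ : CurveClass ℂ} (hγ₀ : (Q.chord 0 2 (by decide)).IsSimpleChord γ₀) :
    IsWeldingStable Q δs a b (fun _ _ => γ₀) := by
  intro x _hx ε hε η hη
  have hcont := (continuousOn_conformalWelding Q x) γ₀ hγ₀
  rw [Metric.continuousWithinAt_iff] at hcont
  obtain ⟨ρ, hρ, hρε⟩ := hcont ε hε
  refine ⟨ρ, hρ, Eventually.of_forall fun n => ?_⟩
  have hempty : ∀ ω : SAW.DomainSAW Q.carrier (δs n) (a (δs n)) (b (δs n)),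
      ¬ ∃ γ' : CurveClass ℂ, (Q.chord 0 2 (by decide)).IsSimpleChord γ' ∧ dist γ' γ₀ < ρ ∧
        ε ≤ |conformalWelding Q γ' x - conformalWelding Q γ₀ x| := by
    rintro ω ⟨γ', hγ', hd, hle⟩
    have h := hρε hγ' hd
    rw [Real.dist_eq] at h
    exact (not_lt.2 hle) h
  have hset : {ω : SAW.DomainSAW Q.carrier (δs n) (a (δs n)) (b (δs n)) |
      ∃ γ' : CurveClass ℂ, (Q.chord 0 2 (by decide)).IsSimpleChord γ' ∧ dist γ' γ₀ < ρ ∧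
        ε ≤ |conformalWelding Q γ' x - conformalWelding Q γ₀ x|} = ∅ :=
    Set.eq_empty_iff_forall_notMem.2 hempty
  show (SAW.law Q.carrier (δs n) (a (δs n)) (b (δs n))).real
      {ω : SAW.DomainSAW Q.carrier (δs n) (a (δs n)) (b (δs n)) |
        ∃ γ' : CurveClass ℂ, (Q.chord 0 2 (by decide)).IsSimpleChord γ' ∧ dist γ' γ₀ < ρ ∧
          ε ≤ |conformalWelding Q γ' x - conformalWelding Q γ₀ x|} ≤ η
  rw [hset, measureReal_empty]
  exact hη.le

/-- If a proxy family carries the SLE_{8/3} welding law then the SAW laws along the sequence are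
eventually probability measures (their mass is `0` or `1` and the `g ≡ 1` marginal tends to `1`).
[folklore] -/
theorem HasSLEWeldingLaw.eventually_isProbabilityMeasure
    {c : (n : ℕ) → SAW.DomainSAW Q.carrier (δs n) (a (δs n)) (b (δs n)) → CurveClass ℂ}
    (hlaw : HasSLEWeldingLaw Q δs a b c) {Γ : (NNReal → ℝ) → CurveClass ℂ}
    (hΓ : IsSLECurve ((8 : NNReal) / 3) (Q.chord 0 2 (by decide)) Γ) :
    ∀ᶠ n in atTop, IsProbabilityMeasure (SAW.law Q.carrier (δs n) (a (δs n)) (b (δs n))) := by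
  haveI : IsProbabilityMeasure preWienerMeasure := isProbabilityMeasure_preWienerMeasure'
  haveI : IsProbabilityMeasure (preWienerMeasure.map Γ) := Measure.isProbabilityMeasure_map hΓ.1
  have h1 := hlaw Γ hΓ 0 (fun _ => 1) (fun _ => one_pos) 1
  simp only [BoundedContinuousFunction.coe_one, Pi.one_apply, integral_const, smul_eq_mul,
    mul_one, probReal_univ] at h1
  have hev := h1.eventually (lt_mem_nhds (show (1 : ℝ) / 2 < 1 by norm_num))
  filter_upwards [hev] with n hn
  rcases Summit.CriticalPhenomena.SAWScalingLimit.Theorems.SubseqIdentification.Negative.isProbabilityMeasure_law_or_eq_zero Q.carrier (δs n)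
    (a (δs n)) (b (δs n)) with h | h
  · exact h
  · exfalso
    rw [h, measureReal_def, Measure.coe_zero, Pi.zero_apply, ENNReal.toReal_zero] at hn
    norm_num at hn

/-- **The stability estimate, one coordinate.** If `c`, `c'` are chord-proxy families of the same
walk and `c'` is welding-stable, then for every `x > 0` and `ε > 0` the probability that their
canonical weldings at `x` differ by more than `ε` tends to `0`: on the complement of the stability
event, `cₙ ω` is itself a simple chord within `ρ` of `c'ₙ ω` (both are within `ρ/3` of the walk)
whose welding is `ε`-close. [folklore] -/
theorem tendsto_measureReal_lt_abs_sub_welding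
    {c c' : (n : ℕ) → SAW.DomainSAW Q.carrier (δs n) (a (δs n)) (b (δs n)) → CurveClass ℂ}
    (hc : IsChordProxy Q δs a b c) (hc' : IsChordProxy Q δs a b c')
    (hst : IsWeldingStable Q δs a b c') {x : ℝ} (hx : 0 < x) {ε : ℝ} (hε : 0 < ε) :
    Tendsto (fun n => (SAW.law Q.carrier (δs n) (a (δs n)) (b (δs n))).real
      {ω | ε < |conformalWelding Q (c n ω) x - conformalWelding Q (c' n ω) x|}) atTop (𝓝 0) := by
  rw [Metric.tendsto_nhds]
  intro η hη
  obtain ⟨ρ, hρ, hbad⟩ := hst x hx ε hε (η / 3) (by positivity)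
  have hρ3 : 0 < ρ / 3 := by positivity
  have h1 := hc.2 (ρ / 3) hρ3
  have h2 := hc'.2 (ρ / 3) hρ3
  rw [Metric.tendsto_nhds] at h1 h2
  filter_upwards [hbad, h1 (η / 3) (by positivity), h2 (η / 3) (by positivity), hc.1]
    with n hbadn h1n h2n hchn
  set μ : Measure (SAW.DomainSAW Q.carrier (δs n) (a (δs n)) (b (δs n))) :=
    SAW.law Q.carrier (δs n) (a (δs n)) (b (δs n)) with hμ
  haveI : IsFiniteMeasure μ := isFiniteMeasure_law _ _ _ _
  -- the four covering events
  set S := {ω : SAW.DomainSAW Q.carrier (δs n) (a (δs n)) (b (δs n)) |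
      ε < |conformalWelding Q (c n ω) x - conformalWelding Q (c' n ω) x|} with hS
  set B := {ω : SAW.DomainSAW Q.carrier (δs n) (a (δs n)) (b (δs n)) |
      ∃ γ' : CurveClass ℂ, (Q.chord 0 2 (by decide)).IsSimpleChord γ' ∧ dist γ' (c' n ω) < ρ ∧
        ε ≤ |conformalWelding Q γ' x - conformalWelding Q (c' n ω) x|} with hB
  set A₁ := {ω : SAW.DomainSAW Q.carrier (δs n) (a (δs n)) (b (δs n)) |
      ρ / 3 < dist ω.curve (c n ω)} with hA₁
  set A₂ := {ω : SAW.DomainSAW Q.carrier (δs n) (a (δs n)) (b (δs n)) |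
      ρ / 3 < dist ω.curve (c' n ω)} with hA₂
  set N := {ω : SAW.DomainSAW Q.carrier (δs n) (a (δs n)) (b (δs n)) |
      ¬ (Q.chord 0 2 (by decide)).IsSimpleChord (c n ω)} with hN
  have hsub : S ⊆ ((B ∪ A₁) ∪ A₂) ∪ N := by
    intro ω hω
    by_cases hch : (Q.chord 0 2 (by decide)).IsSimpleChord (c n ω)
    · by_cases hd : dist (c n ω) (c' n ω) < ρ
      · exact Or.inl (Or.inl (Or.inl ⟨c n ω, hch, hd, le_of_lt hω⟩))
      · -- the two proxies are `ρ`-apart, so one of them is `ρ/3`-far from the walk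
        have htri : dist (c n ω) (c' n ω) ≤ dist ω.curve (c n ω) + dist ω.curve (c' n ω) := by
          calc dist (c n ω) (c' n ω) ≤ dist (c n ω) ω.curve + dist ω.curve (c' n ω) :=
                dist_triangle _ _ _
            _ = dist ω.curve (c n ω) + dist ω.curve (c' n ω) := by rw [dist_comm (c n ω)]
        have hρle : ρ ≤ dist ω.curve (c n ω) + dist ω.curve (c' n ω) := (not_lt.1 hd).trans htri
        by_cases h₁ : ρ / 3 < dist ω.curve (c n ω)
        · exact Or.inl (Or.inl (Or.inr h₁))
        · have h₂ : ρ / 3 < dist ω.curve (c' n ω) := by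
            have := not_lt.1 h₁
            linarith
          exact Or.inl (Or.inr h₂)
    · exact Or.inr hch
  have hN0 : μ.real N = 0 := by
    have h0 : μ N = 0 := ae_iff.1 hchn
    rw [measureReal_def, h0, ENNReal.toReal_zero]
  have hA₁' : μ.real A₁ < η / 3 := by
    have := h1n
    rwa [Real.dist_eq, sub_zero, abs_of_nonneg measureReal_nonneg] at this
  have hA₂' : μ.real A₂ < η / 3 := by
    have := h2n
    rwa [Real.dist_eq, sub_zero, abs_of_nonneg measureReal_nonneg] at this
  have hmono : μ.real S ≤ μ.real (((B ∪ A₁) ∪ A₂) ∪ N) := measureReal_mono hsub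
  have hu1 : μ.real (((B ∪ A₁) ∪ A₂) ∪ N) ≤ μ.real ((B ∪ A₁) ∪ A₂) + μ.real N :=
    measureReal_union_le _ _
  have hu2 : μ.real ((B ∪ A₁) ∪ A₂) ≤ μ.real (B ∪ A₁) + μ.real A₂ := measureReal_union_le _ _
  have hu3 : μ.real (B ∪ A₁) ≤ μ.real B + μ.real A₁ := measureReal_union_le _ _
  rw [Real.dist_eq, sub_zero, abs_of_nonneg measureReal_nonneg]
  linarith

/-- Measurability of the welding vector (from the tree, restated for the local `open`s). [folklore] -/
theorem measurable_weldingVector' (Q : ConformalRectangle) {k : ℕ} (x : Fin k → ℝ) :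
    Measurable fun (γ : CurveClass ℂ) (i : Fin k) => conformalWelding Q γ (x i) :=
  measurable_pi_lambda _ fun i => measurable_conformalWelding Q (x i)

/-- **Transfer of the welding law along stable families.** If a chord-proxy family `c` carries the
SLE_{8/3} welding law, then so does every welding-STABLE chord-proxy family `c'` of the same walks:
the welding vectors of `c` and `c'` at `x₁, …, x_k` are `ε`-close in probability (the stability
estimate, coordinatewise, and the sup metric on `ℝᵏ`), so the two sequences of laws converge
together (Billingsley 1999 Thm 3.1, tree: `tendsto_integral_comp_of_tendsto_measureReal_lt_dist`).
[folklore] -/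
theorem HasSLEWeldingLaw.transfer
    {c c' : (n : ℕ) → SAW.DomainSAW Q.carrier (δs n) (a (δs n)) (b (δs n)) → CurveClass ℂ}
    (hlaw : HasSLEWeldingLaw Q δs a b c) (hc : IsChordProxy Q δs a b c)
    (hc' : IsChordProxy Q δs a b c') (hst : IsWeldingStable Q δs a b c') :
    HasSLEWeldingLaw Q δs a b c' := by
  intro Γ hΓ k x hx g
  haveI : IsProbabilityMeasure preWienerMeasure := isProbabilityMeasure_preWienerMeasure'
  haveI : IsProbabilityMeasure (preWienerMeasure.map Γ) := Measure.isProbabilityMeasure_map hΓ.1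
  have hVm := measurable_weldingVector' Q x
  set ν : Measure (Fin k → ℝ) :=
    (preWienerMeasure.map Γ).map (fun γ (i : Fin k) => conformalWelding Q γ (x i)) with hν
  haveI : IsProbabilityMeasure ν := Measure.isProbabilityMeasure_map hVm.aemeasurable
  set μ : (n : ℕ) → Measure (SAW.DomainSAW Q.carrier (δs n) (a (δs n)) (b (δs n))) :=
    fun n => SAW.law Q.carrier (δs n) (a (δs n)) (b (δs n)) with hμdef
  set X : (n : ℕ) → SAW.DomainSAW Q.carrier (δs n) (a (δs n)) (b (δs n)) → (Fin k → ℝ) :=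
    fun n ω i => conformalWelding Q (c n ω) (x i) with hXdef
  set Y : (n : ℕ) → SAW.DomainSAW Q.carrier (δs n) (a (δs n)) (b (δs n)) → (Fin k → ℝ) :=
    fun n ω i => conformalWelding Q (c' n ω) (x i) with hYdef
  have hμ : ∀ᶠ n in atTop, IsProbabilityMeasure (μ n) := hlaw.eventually_isProbabilityMeasure hΓ
  -- the laws of `X n` converge to `ν`
  have hlimX : ∀ f : (Fin k → ℝ) →ᵇ ℝ,
      Tendsto (fun n => ∫ ω, f (X n ω) ∂μ n) atTop (𝓝 (∫ y, f y ∂ν)) := by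
    intro f
    have e : ∫ y, f y ∂ν = ∫ γ, f (fun i => conformalWelding Q γ (x i)) ∂(preWienerMeasure.map Γ) :=
      integral_map hVm.aemeasurable f.continuous.aestronglyMeasurable
    rw [e]
    exact hlaw Γ hΓ k x hx f
  -- `X n` and `Y n` are close in probability: coordinatewise stability + sup metric
  have hd : ∀ ε : ℝ, 0 < ε →
      Tendsto (fun n => (μ n).real {ω | ε < dist (X n ω) (Y n ω)}) atTop (𝓝 0) := by
    intro ε hε
    have hsub : ∀ n, {ω | ε < dist (X n ω) (Y n ω)} ⊆
        ⋃ i : Fin k, {ω | ε < |conformalWelding Q (c n ω) (x i) - conformalWelding Q (c' n ω) (x i)|} := by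
      intro n ω hω
      by_contra hcon
      simp only [mem_iUnion, mem_setOf_eq, not_exists, not_lt] at hcon
      have hle : dist (X n ω) (Y n ω) ≤ ε :=
        (dist_pi_le_iff hε.le).2 fun i => by rw [Real.dist_eq]; exact hcon i
      exact (lt_irrefl ε) (lt_of_lt_of_le hω hle)
    have hbound : ∀ n, (μ n).real {ω | ε < dist (X n ω) (Y n ω)} ≤
        ∑ i : Fin k, (μ n).real
          {ω | ε < |conformalWelding Q (c n ω) (x i) - conformalWelding Q (c' n ω) (x i)|} := by
      intro n
      haveI : IsFiniteMeasure (μ n) := isFiniteMeasure_law _ _ _ _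
      exact (measureReal_mono (hsub n)).trans (measureReal_iUnion_fintype_le _)
    have hsum : Tendsto (fun n => ∑ i : Fin k, (μ n).real
        {ω | ε < |conformalWelding Q (c n ω) (x i) - conformalWelding Q (c' n ω) (x i)|})
        atTop (𝓝 0) := by
      have h := tendsto_finsetSum (Finset.univ : Finset (Fin k))
        (fun i _ => tendsto_measureReal_lt_abs_sub_welding hc hc' hst (hx i) hε)
      simpa using h
    exact squeeze_zero (fun n => measureReal_nonneg) hbound hsum
  have key := Summit.CriticalPhenomena.SAWScalingLimit.Theorems.WeldingLawOfLimit.tendsto_integral_comp_of_tendsto_measureReal_lt_dist (l := atTop)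
    (μ := μ) hμ (X := X) (Y := Y)
    (Eventually.of_forall fun n => (SAW.DomainSAW.measurable_of_top _).aemeasurable)
    (Eventually.of_forall fun n => (SAW.DomainSAW.measurable_of_top _).aemeasurable) ν hlimX hd g
  have e : ∫ y, g y ∂ν = ∫ γ, g (fun i => conformalWelding Q γ (x i)) ∂(preWienerMeasure.map Γ) :=
    integral_map hVm.aemeasurable g.continuous.aestronglyMeasurable
  rw [e] at key
  exact key

end Glue

/-! ### 4. Relations between the stubs, the leaf and the crux (sorry-free) -/

/-- **Stub A ∧ Stub B ⇒ the leaf `LatticeWeldingLaw`** (take the stable family, identify it). -/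
theorem latticeWeldingLaw_of (hA : StableChordProxies) (hB : WeldingLawOfStableProxies) :
    LatticeWeldingLaw := by
  intro Q a b hab δs hpos hδ
  obtain ⟨c, hc, hst⟩ := hA Q a b hab δs hpos hδ
  exact ⟨c, hc.1, hc.2, hB Q a b hab δs hpos hδ c hc hst⟩

/-- **The leaf implies Stub B** (transfer along stable families): the identification stub is a
CONSEQUENCE of `LatticeWeldingLaw`, hence not stronger than the conjunct. [folklore] -/
theorem weldingLawOfStableProxies_of_latticeWeldingLaw (hL : LatticeWeldingLaw) :
    WeldingLawOfStableProxies := by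
  intro Q a b hab δs hpos hδ c' hc' hst
  obtain ⟨c, hch, hd, hlaw⟩ := hL Q a b hab δs hpos hδ
  exact HasSLEWeldingLaw.transfer hlaw ⟨hch, hd⟩ hc' hst

/-- **Given Stub A, the leaf and Stub B are equivalent**: the cut loses and adds nothing. [folklore] -/
theorem latticeWeldingLaw_iff_of_stableChordProxies (hA : StableChordProxies) :
    LatticeWeldingLaw ↔ WeldingLawOfStableProxies :=
  ⟨weldingLawOfStableProxies_of_latticeWeldingLaw, latticeWeldingLaw_of hA⟩

/-- **Stub B follows from the conjunct** `SAWScalingLimit` (through the leaf: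
`latticeWeldingLaw_of_sawScalingLimit'`, p164708). [folklore] -/
theorem weldingLawOfStableProxies_of_sawScalingLimit (hS : _root_.SAWScalingLimit) :
    WeldingLawOfStableProxies :=
  weldingLawOfStableProxies_of_latticeWeldingLaw
    (Summit.CriticalPhenomena.SAWScalingLimit.Theorems.WeldingLawOfLimit.latticeWeldingLaw_of_sawScalingLimit' hS)

/-! ### 5. The composition: the stubs imply the crux BY NAME -/

/-- **Skeleton theorem.** `SimpleSubseqLimits → StableChordProxies → WeldingLawOfStableProxies →
WeldingLawOfLimit`: Stubs A, B give the leaf `LatticeWeldingLaw` (`latticeWeldingLaw_of`), and the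
landed route-level assembly `weldingLawOfLimit_of_simpleSubseqLimits_of_latticeWeldingLaw` (p161228:
converging together on varying spaces, continuous mapping on the Borel chord set carried by the
limit thanks to stub 1, welding uniqueness for the pinned functional) gives the crux. -/
theorem WeldingLawOfLimit_of (h1 : Registered.stub_simpleSubseqLimits)
    (hA : Registered.stub_stableChordProxies) (hB : Registered.stub_weldingLawOfStableProxies) :
    Summit.CriticalPhenomena.SAWScalingLimit.Theses.SAWWeldingIdentification.WeldingLawOfLimit :=
  Summit.CriticalPhenomena.SAWScalingLimit.Theorems.WeldingLawOfLimit.weldingLawOfLimit_of_simpleSubseqLimits_of_latticeWeldingLaw h1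
    (latticeWeldingLaw_of hA hB)

/-- Wiring check: the registered stubs feed `WeldingLawOfLimit_of` as stated. -/
example : Summit.CriticalPhenomena.SAWScalingLimit.Theses.SAWWeldingIdentification.WeldingLawOfLimit :=
  WeldingLawOfLimit_of stub_simpleSubseqLimits stub_stableChordProxies stub_weldingLawOfStableProxies

/-- Wiring check for the leaf: Stubs A, B feed `latticeWeldingLaw_of`. -/
example : LatticeWeldingLaw := latticeWeldingLaw_of stub_stableChordProxies stub_weldingLawOfStableProxies

end Summit.CriticalPhenomena.SAWScalingLimit.Cruxes.WeldingLawOfLimit.StableProxies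

end
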